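import Summits.QuantumAdvantage.AdviceFreeQNC0.LiftFromTransversal
import Summits.QuantumAdvantage.AdviceFreeQNC0.LiftOneUBookkeeping
import Mathlib.Data.Nat.Choose.Bounds
import HarnessLib

/-!
# Cell qa-qnc0 (rung F-S1, route RingFrame, crux α, line `tensor`): EVERY FIXED-GAP RUNG OF R1U BY
# COUNTING — `liftOneUAt_counting : ∀ c, LiftOneUAt c ((c+1)·2^c/8)` (qn-p2 gen 6 ask R6-a)

Planner qa-qnc0-p2 gen 6's COUNTING LEMMA (INBOX 2026-08-27T07:09Z, ROUND-6 §1): for any gap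
`c = L' − d` and any radius system — `X` with linear columns, rows `w`-close to `RM(d, d+c)` — the
row-coset space `M_X ≤ 𝔽₂^{{0,1}^m} / RM(d, m)` (`m = d + c`; `LiftCounting.rowsp`, the plain quotient,
no syndromes) INJECTS into the words of weight `≤ w` (distinct cosets have distinct leaders), so
`2^{dim M} ≤ Σ_{j ≤ w} C(2^m, j) ≤ (2^m + 1)^w`, i.e. **`dim M ≤ w·(m+1)`** (`finrank_rowsp_le`).  With the
transversal `Z = ⋃` leaders of a basis (`#Z ≤ w·dim M ≤ w²(d+c+1)`, `exists_transversal`) and the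
literature seat's `exists_lift_of_transversal_real`, the lift costs
`≤ w²(d+c+1)·2^L/2 ≤ ((c+1)2^c/8)·(d+2)·w·2^L` (as `w ≤ 2^{c−1}` and `d+c+1 ≤ (c+1)(d+2)/2`):
**`liftOneUAt_counting`** — the rungs E1 (`c = 2`, `K = 1.5`), E2 (`c = 3`, `K = 4`), E3 (`c = 4`, `K = 10`),
… all at once (the cell's E1/E2 files give the sharper `K = 1, 2` and the `6m+4` transversal).

The cell's theorem (planner qa-qnc0-p2 gen 6, ask R6-a; prover qa-qnc0-prover gen 6, 2026-08-27).
WHAT THIS IS NOT: nothing on `LiftOneU` itself (ONE constant for all gaps — the joint limit `d, c → ∞`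
stays open), on the radius decay `γ_d`, TR⁺, α or the separation.
-/

noncomputable section

namespace Summit.QuantumAdvantage.AdviceFreeQNC0

open Finset Module
open Literature.Computability.MetaComplexity Literature.Computability.MetaComplexity.Smolensky
open MeanLoad LiftFromTransversal

namespace LiftCounting

variable {L m : ℕ}

/-! ### Rows modulo `RM(d, m)` -/

/-- the quotient map by `RM(d, m)`. -/
abbrev mkQ (m d : ℕ) : CubeFn (ZMod 2) m →ₗ[ZMod 2] CubeFn (ZMod 2) m ⧸ lowDeg (ZMod 2) m d :=
  (lowDeg (ZMod 2) m d).mkQ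

/-- the row-coset space `M_X` of `X` modulo `RM(d, m)`. -/
def rowsp (X : BMat L m) (d : ℕ) : Submodule (ZMod 2) (CubeFn (ZMod 2) m ⧸ lowDeg (ZMod 2) m d) :=
  (Submodule.span (ZMod 2) (Set.range fun u => indB (X u))).map (mkQ m d)

/-- Rows of a matrix with linear columns are additive. -/
theorem indB_bx {X : BMat L m} (hX : LinCols X) (u u' : Fin L → Bool) :
    indB (X (bx u u')) = indB (X u) + indB (X u') := by
  funext v
  rw [Pi.add_apply, indB_apply, indB_apply, indB_apply, apply_bx_of_linCols hX u u' v, ind_xor]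

/-- The row at `u = 0` vanishes. -/
theorem indB_zero {X : BMat L m} (hX : LinCols X) : indB (X fun _ => false) = 0 := by
  funext v
  rw [indB_apply, hX.2 v]
  rfl

/-- Every element of the span of the rows is a row. -/
theorem exists_row_of_mem_span {X : BMat L m} (hX : LinCols X) {g : CubeFn (ZMod 2) m}
    (hg : g ∈ Submodule.span (ZMod 2) (Set.range fun u => indB (X u))) : ∃ u, indB (X u) = g := by
  induction hg using Submodule.span_induction with
  | mem g hg =>
    obtain ⟨u, rfl⟩ := hg
    exact ⟨u, rfl⟩
  | zero => exact ⟨fun _ => false, indB_zero hX⟩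
  | add g g' _ _ hg hg' =>
    obtain ⟨u, rfl⟩ := hg
    obtain ⟨u', rfl⟩ := hg'
    exact ⟨bx u u', indB_bx hX u u'⟩
  | smul c g _ hg =>
    obtain ⟨u, rfl⟩ := hg
    have hc : c = 0 ∨ c = 1 := by revert c; decide
    rcases hc with rfl | rfl
    · exact ⟨fun _ => false, by rw [indB_zero hX, zero_smul]⟩
    · exact ⟨u, by rw [one_smul]⟩

/-- **Every element of `M_X` is the class of an actual row.** -/
theorem exists_row_of_mem_rowsp {X : BMat L m} (hX : LinCols X) {d : ℕ}
    {q : CubeFn (ZMod 2) m ⧸ lowDeg (ZMod 2) m d} (hq : q ∈ rowsp X d) : ∃ u, mkQ m d (indB (X u)) = q := by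
  obtain ⟨g, hg, rfl⟩ := Submodule.mem_map.1 hq
  obtain ⟨u, hu⟩ := exists_row_of_mem_span hX hg
  exact ⟨u, by rw [hu]⟩

/-! ### Leaders -/

/-- the leader of row `u` as a set of columns. -/
def leaderF (X Y : BMat L m) (u : Fin L → Bool) : Finset (Fin m → Bool) :=
  univ.filter fun v => ldr X Y u v = true

/-- `#leaderF = rowDist`. -/
theorem card_leaderF (X Y : BMat L m) (u : Fin L → Bool) : (leaderF X Y u).card = rowDist X Y u :=
  (rowDist_eq_card_ldr X Y u).symm

/-- the indicator of a set of columns. -/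
def indS (a : Finset (Fin m → Bool)) : CubeFn (ZMod 2) m := fun v => if v ∈ a then 1 else 0

/-- `X(u,·) = Y(u,·) + 𝟙_{leader}`. -/
theorem indB_eq_add_indS (X Y : BMat L m) (u : Fin L → Bool) :
    indB (X u) = indB (Y u) + indS (leaderF X Y u) := by
  funext v
  simp only [Pi.add_apply, indB_apply, indS, leaderF, Finset.mem_filter, Finset.mem_univ, true_and, ldr]
  cases X u v <;> cases Y u v <;> decide

/-- **The leader represents the row's coset.** -/
theorem mkQ_indS_leader {X Y : BMat L m} {d : ℕ} (hY : RowsDeg d Y) (u : Fin L → Bool) :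
    mkQ m d (indS (leaderF X Y u)) = mkQ m d (indB (X u)) := by
  rw [indB_eq_add_indS X Y u, map_add]
  have h : mkQ m d (indB (Y u)) = 0 := by
    rw [Submodule.mkQ_apply, Submodule.Quotient.mk_eq_zero]
    exact hY u
  rw [h, zero_add]

/-! ### Counting light words -/

/-- `Σ_{j ≤ w} C(n, j) ≤ (n+1)^w`. [folklore] -/
theorem sum_choose_le_pow (n w : ℕ) : ∑ j ∈ range (w + 1), n.choose j ≤ (n + 1) ^ w := by
  induction w with
  | zero => simp
  | succ w ih =>
    rw [Finset.sum_range_succ, pow_succ]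
    have h1 : n.choose (w + 1) ≤ n * (n + 1) ^ w := by
      calc n.choose (w + 1) ≤ n ^ (w + 1) := Nat.choose_le_pow n (w + 1)
        _ = n * n ^ w := by ring
        _ ≤ n * (n + 1) ^ w := Nat.mul_le_mul_left _ (Nat.pow_le_pow_left (Nat.le_succ n) w)
    nlinarith

/-- The sets of `≤ w` points number at most `(2^m + 1)^w`. -/
theorem card_light_le (m w : ℕ) :
    ((univ : Finset (Finset (Fin m → Bool))).filter fun S => S.card ≤ w).card ≤ (2 ^ m + 1) ^ w := by
  have hsub : ((univ : Finset (Finset (Fin m → Bool))).filter fun S => S.card ≤ w) ⊆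
      (range (w + 1)).biUnion fun j => (univ : Finset (Fin m → Bool)).powersetCard j := by
    intro S hS
    rw [Finset.mem_filter] at hS
    rw [Finset.mem_biUnion]
    exact ⟨S.card, Finset.mem_range.2 (Nat.lt_succ_of_le hS.2),
      Finset.mem_powersetCard.2 ⟨Finset.subset_univ S, rfl⟩⟩
  refine (Finset.card_le_card hsub).trans (Finset.card_biUnion_le.trans ?_)
  have hn : (univ : Finset (Fin m → Bool)).card = 2 ^ m := by
    rw [Finset.card_univ, Fintype.card_fun, Fintype.card_bool, Fintype.card_fin]
  calc ∑ j ∈ range (w + 1), ((univ : Finset (Fin m → Bool)).powersetCard j).card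
      = ∑ j ∈ range (w + 1), (2 ^ m).choose j :=
        Finset.sum_congr rfl fun j _ => by rw [Finset.card_powersetCard, hn]
    _ ≤ (2 ^ m + 1) ^ w := sum_choose_le_pow _ _

/-- **COUNTING LEMMA**: `dim M_X ≤ w·(m+1)` — distinct cosets have distinct leaders (`≤ w` points). -/
theorem finrank_rowsp_le {X Y : BMat L m} {d w : ℕ} (hX : LinCols X) (hY : RowsDeg d Y)
    (hdist : ∀ u, rowDist X Y u ≤ w) : finrank (ZMod 2) (rowsp X d) ≤ w * (m + 1) := by
  classical
  haveI : Fintype (rowsp X d) := Fintype.ofFinite _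
  -- a row for every coset, and its leader
  have hrow : ∀ q : rowsp X d, ∃ u, mkQ m d (indB (X u)) = q := fun q => exists_row_of_mem_rowsp hX q.2
  choose urow hurow using hrow
  set lightSet := ((univ : Finset (Finset (Fin m → Bool))).filter fun S => S.card ≤ w) with hlight
  have hmem : ∀ q : rowsp X d, leaderF X Y (urow q) ∈ lightSet := fun q => by
    rw [hlight, Finset.mem_filter, card_leaderF]
    exact ⟨Finset.mem_univ _, hdist _⟩
  have hinj : Function.Injective (fun q : rowsp X d => (⟨leaderF X Y (urow q), hmem q⟩ : {S // S ∈ lightSet})) := by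
    intro q q' h
    have h' : leaderF X Y (urow q) = leaderF X Y (urow q') := congrArg Subtype.val h
    apply Subtype.ext
    rw [← hurow q, ← hurow q', ← mkQ_indS_leader hY, ← mkQ_indS_leader hY, h']
  have hcard := Fintype.card_le_of_injective _ hinj
  rw [Fintype.card_coe, Module.card_eq_pow_finrank (K := ZMod 2) (V := rowsp X d), ZMod.card] at hcard
  have h2 : 2 ^ finrank (ZMod 2) (rowsp X d) ≤ 2 ^ (w * (m + 1)) := by
    calc 2 ^ finrank (ZMod 2) (rowsp X d) ≤ lightSet.card := hcard
      _ ≤ (2 ^ m + 1) ^ w := card_light_le m w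
      _ ≤ (2 ^ (m + 1)) ^ w := Nat.pow_le_pow_left (by
          have := Nat.one_le_two_pow (n := m); rw [pow_succ]; omega) w
      _ = 2 ^ (w * (m + 1)) := by rw [← pow_mul, mul_comm]
  exact (Nat.pow_le_pow_iff_right (by norm_num)).1 h2

/-! ### The transversal -/

/-- **The transversal**: every row coset has a representative supported on a set `Z` of
`≤ w·dim M_X ≤ w²(m+1)` columns (leaders of the rows realising a basis of `M_X`). -/
theorem exists_transversal {X Y : BMat L m} {d w : ℕ} (hX : LinCols X) (hY : RowsDeg d Y)
    (hdist : ∀ u, rowDist X Y u ≤ w) :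
    ∃ Z : Finset (Fin m → Bool), Z.card ≤ w * (w * (m + 1)) ∧
      ∀ u, ∃ v : (Fin m → Bool) → Bool, (∀ p, v p = true → p ∈ Z) ∧ HasDeg (fun p => xor (X u p) (v p)) d := by
  classical
  set b := Module.finBasis (ZMod 2) (rowsp X d) with hb
  have hrow : ∀ i, ∃ u, mkQ m d (indB (X u)) = (b i : _) := fun i => exists_row_of_mem_rowsp hX (b i).2
  choose ub hub using hrow
  set Z : Finset (Fin m → Bool) := univ.biUnion fun i => leaderF X Y (ub i) with hZ
  refine ⟨Z, ?_, fun u => ?_⟩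
  · calc Z.card ≤ ∑ i, (leaderF X Y (ub i)).card := Finset.card_biUnion_le
      _ ≤ ∑ _i : Fin (finrank (ZMod 2) (rowsp X d)), w :=
          Finset.sum_le_sum fun i _ => by rw [card_leaderF]; exact hdist _
      _ ≤ w * (w * (m + 1)) := by
          rw [Finset.sum_const, Finset.card_univ, Fintype.card_fin, smul_eq_mul, mul_comm]
          exact Nat.mul_le_mul_left _ (finrank_rowsp_le hX hY hdist)
  · -- coefficients of the row's coset on the basis
    set q : rowsp X d := ⟨mkQ m d (indB (X u)), Submodule.mem_map_of_mem (Submodule.subset_span ⟨u, rfl⟩)⟩ with hq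
    set g : CubeFn (ZMod 2) m := ∑ i, (b.repr q i) • indS (leaderF X Y (ub i)) with hg
    have hgq : mkQ m d g = mkQ m d (indB (X u)) := by
      rw [hg, map_sum]
      simp only [map_smul, mkQ_indS_leader hY, hub]
      have h := b.sum_repr q
      have h' := congrArg (fun t : rowsp X d => (t : CubeFn (ZMod 2) m ⧸ lowDeg (ZMod 2) m d)) h
      simp only [Submodule.coe_sum, Submodule.coe_smul] at h'
      exact h'
    refine ⟨fun p => decide (g p = 1), fun p hp => ?_, ?_⟩
    · by_contra hpZ
      have hgp : g p = 0 := by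
        rw [hg, Finset.sum_apply]
        refine Finset.sum_eq_zero fun i _ => ?_
        have hpi : p ∉ leaderF X Y (ub i) := fun h =>
          hpZ (by rw [hZ]; exact Finset.mem_biUnion.2 ⟨i, Finset.mem_univ _, h⟩)
        simp [indS, hpi]
      have hp' : decide (g p = 1) = true := hp
      rw [hgp] at hp'
      exact absurd hp' (by decide)
    · show (fun p => if xor (X u p) (decide (g p = 1)) = true then (1 : ZMod 2) else 0) ∈ lowDeg (ZMod 2) m d
      have h : (fun p => if xor (X u p) (decide (g p = 1)) = true then (1 : ZMod 2) else 0) = indB (X u) + g := by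
        funext p
        rw [ind_xor, zmod2_ind_decide, Pi.add_apply, indB_apply]
      rw [h]
      have hdiff : indB (X u) - g ∈ lowDeg (ZMod 2) m d := by
        rw [← Submodule.Quotient.eq]
        exact hgq.symm
      have hsub : indB (X u) - g = indB (X u) + g := by
        funext p
        rw [Pi.sub_apply, Pi.add_apply, sub_eq_add_neg, ZMod.neg_eq_self_mod_two]
      rwa [hsub] at hdiff

end LiftCounting

/-! ### Every fixed-gap rung -/

open LiftCounting in
/-- **`liftOneUAt_counting`: for every gap `c`, `LiftOneUAt c ((c+1)·2^c/8)`** — R1U holds at every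
FIXED co-degree, with a constant growing like `2^c` (qn-p2 gen 6 ask R6-a; counting lemma). -/
theorem liftOneUAt_counting : ∀ c : ℕ, LiftOneUAt c (((c : ℝ) + 1) * 2 ^ c / 8) := by
  intro c L d w hw X Y hX hY hdist
  rcases Nat.eq_zero_or_pos w with rfl | hwpos
  · -- `w = 0`: the rows of `X` are those of `Y`; `W = X`
    refine ⟨X, hX, fun u => ?_, ?_⟩
    · have e : X u = Y u := row_eq_of_rowDist_eq_zero (Nat.le_zero.1 (hdist u))
      have hYu := hY u
      rw [← e] at hYu
      exact hYu
    · rw [hw_xorM_self]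
      simp
  -- `w ≥ 1` forces `c ≥ 1`
  have hc : 1 ≤ c := by
    rcases Nat.eq_zero_or_pos c with h | h
    · subst h; simp at hw; omega
    · exact h
  obtain ⟨Z, hZ, H⟩ := exists_transversal (m := d + c) hX hY hdist
  obtain ⟨W, hW, hWd, hcost⟩ := exists_lift_of_transversal_real Z hX H
  refine ⟨W, hW, hWd, hcost.trans ?_⟩
  have hZR : (Z.card : ℝ) ≤ w * (w * (d + c + 1)) := by exact_mod_cast hZ
  have hw2 : (2 : ℝ) * w ≤ (2 : ℝ) ^ c := by exact_mod_cast hw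
  have hdc : (2 : ℝ) * (d + c + 1) ≤ (c + 1) * (d + 2) := by
    have h : 2 * (d + c + 1) ≤ (c + 1) * (d + 2) := by nlinarith
    exact_mod_cast h
  have hpos : (0 : ℝ) ≤ (2 : ℝ) ^ L := by positivity
  have hw0 : (0 : ℝ) ≤ w := by positivity
  have hd0 : (0 : ℝ) ≤ (d : ℝ) + c + 1 := by positivity
  -- `#Z · 2^L / 2 ≤ w²(d+c+1) 2^L / 2 ≤ (c+1) 2^c (d+2) w 2^L / 8`
  have hkey : (w : ℝ) * (w * (d + c + 1)) ≤ ((c : ℝ) + 1) * 2 ^ c / 8 * (d + 2) * w * 2 := by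
    have h1 : (w : ℝ) * (d + c + 1) ≤ 2 ^ c / 2 * ((c + 1) * (d + 2) / 2) := by
      calc (w : ℝ) * (d + c + 1) ≤ (2 ^ c / 2) * (d + c + 1) := by
            apply mul_le_mul_of_nonneg_right _ hd0; linarith
        _ ≤ 2 ^ c / 2 * ((c + 1) * (d + 2) / 2) := by
            apply mul_le_mul_of_nonneg_left _ (by positivity); linarith
    calc (w : ℝ) * (w * (d + c + 1)) = w * (w * (d + c + 1)) := rfl
      _ ≤ w * (2 ^ c / 2 * ((c + 1) * (d + 2) / 2)) := mul_le_mul_of_nonneg_left h1 hw0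
      _ = ((c : ℝ) + 1) * 2 ^ c / 8 * (d + 2) * w * 2 := by ring
  calc (Z.card : ℝ) * (2 : ℝ) ^ L / 2 ≤ w * (w * (d + c + 1)) * (2 : ℝ) ^ L / 2 := by gcongr
    _ ≤ ((c : ℝ) + 1) * 2 ^ c / 8 * (d + 2) * w * 2 * (2 : ℝ) ^ L / 2 := by gcongr
    _ = ((c : ℝ) + 1) * 2 ^ c / 8 * (d + 2) * w * (2 : ℝ) ^ L := by ring

end Summit.QuantumAdvantage.AdviceFreeQNC0

end
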